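import Summits.QuantumFields.YangMills.Theorems.UnitScaleTiltProp7SectET3DeltaPiT3PInv
import Literature.MathematicalPhysics.QuantumFieldTheory.Balaban1983to89.T3Thm1Carrier
import Literature.MathematicalPhysics.QuantumFieldTheory.Balaban1983to89.T3PrintedRegularMinimiser
import HarnessLib

/-!
# Route `UnitScaleTilt`, crux «MinimiserStabilityRegPr» (stmt-QuantumFields-19200), stub EX, route (α) — **WHAT THE DISPLAYED N06 ROW `hPcol` FORCES ON THE RESIDUAL GAUGE
# ALGEBRA: THE COLUMN OPERATOR `G′ᴾ∘R_S∘D*` INVERTS `D_{U₀}` ON `N_S(U₀) ⊖ ker D_{U₀}`, SO `hPcol` IS A UNIFORM ℓ¹-POINCARÉ INEQUALITY ON `N_S(U₀)` OVER ALL OF `RegPr`**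
# (cell `ym3-torus`, width seat `ym3-torus-px12` gen 11; LOCATE «STRATUM (c) AND THE 13 N06 ROWS», 19200 evidence n = 49)

THEOREMS ONLY (0 `def`, 0 `sorry`); `--supports stmt-QuantumFields-19200 --as helper`, count-neutral.  YM₃ on T³ is ladder rung R3 — NOT d = 4, NOT the Clay problem, no mass gap;
nothing here claims a row, the stub or the crux.

THE POINT.  The EX display S42ᴸ (✓`Prop7StubEXOfChartPiecesTwS42L`, rows :185–188) carries the print-shape hypothesis
`hPcol : ∀ L > 1, ∀ i U₀ ρ, RegPr … ρ U₀ → ρ ≤ αcap L → ∀ bd E, Σ_x ‖toL2S⁻¹(G′ᴾ(U₀)(R_S(U₀)(D*_{U₀}(toL2(δ_bd·E))))) x‖ ≤ p139 L·‖E‖` ([Balaban1985Variational] p.299 l.6 «`G′RD*` is a bounded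
operator in the norm |·|₍₁₎», read at the INTRINSIC letters of ★★OWNER ACK 32 (q1) ∕ RULING g28-№4 (C2′): `N_S := ker (Q∘D)`, `R_S`, `G′ᴾ`).  Three landed identities — `R_S` fixes `Δ^η N_S`
(✓`RS_apply_covLapSite_of_mem`), `Δ′_a = Δ^η` on `N_S` (✓`laplacePrimeA_apply_of_mem_NS`), `G′ᴾΔ′_a = 1 − P₀` (✓`GprimeP_laplacePrimeA`) — give §1 (G): **`G′ᴾ R_S D* (Dν) = ν − P₀ν` for
`ν ∈ N_S(U₀)`**, at EVERY background and every `0 ≤ a`.  Decomposing `Dν` over one-bond fields and summing the columns, §2: **`hPcol` ⟹ `Σ_x ‖(ν − P₀ν)(x)‖ ≤ p139 L · Σ_b ‖(D_{U₀}ν)(b)‖`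
for every `U₀ ∈ RegPr (αcap L)` and every `ν` with `toL2S ν ∈ N_S(U₀)`** — a Poincaré inequality on the residual gauge algebra with an `L`-only constant, uniform over the printed-regular
class.  By ✓`Prop7NSOfParallelTopMean.mem_NS_iff_topMean_parallel` (★p1 g21), `N_S(U₀)` = {top nested mean `Ū₀`-parallel}; on the stratum «`Ū₀` reducible, `U₀` irreducible» (✓px20
`Prop7NestedMeanParallelLift`, px10) `N_S ⊖ ker D` contains delocalised low modes, so §2 is the socket at which a `Lift`-shaped antecedent (the LIFT-THREAD text of record) has to enter.
HONEST SCOPE.  Linear algebra and bookkeeping over landed letters; no estimate; no display change; `hPcol` itself is neither proved nor refuted in the tree by this file.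

References: T. Bałaban, CMP **99** (1985) 389–434 [Balaban1985BackgroundPropagators] ((3.21)–(3.25) p.394, (3.118)–(3.119) p.419); CMP **102** (1985) 277–309 [Balaban1985Variational]
((138)–(139) p.299).
-/

set_option autoImplicit false

noncomputable section

open scoped BigOperators Matrix.Norms.L2Operator Matrix InnerProductSpace

namespace Summit.QuantumFields.YangMills.Theorems.Prop7PcolImpliesNSPoincare

open Literature.MathematicalPhysics.QuantumFieldTheory.Balaban1983to89
open Literature.MathematicalPhysics.QuantumFieldTheory.Balaban1983to89.T3ContinuumYM3Torus
open Literature.MathematicalPhysics.QuantumFieldTheory.Balaban1983to89.T3Thm1Carrier (Idx)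
open Literature.MathematicalPhysics.QuantumFieldTheory.Balaban1983to89.T3PrintedRegularMinimiser (RegPr)
open B11Eq103H1Complex (SiteL2K BondL2K)
open Summit.QuantumFields.YangMills.Theorems.Prop7SectET3Transport (periodsT3)
open Summit.QuantumFields.YangMills.Theorems.Prop7SectET3HilbertLetters (W₂ toL2 toL2S DL2 DstarL2 covLapSite)
open Summit.QuantumFields.YangMills.Theorems.Prop7SectET3GaugeProjector (NS RS RS_apply_covLapSite_of_mem)
open Summit.QuantumFields.YangMills.Theorems.Prop7SectET3DeltaPi (laplacePrimeA laplacePrimeA_apply_of_mem_NS)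
open Summit.QuantumFields.YangMills.Theorems.Prop7SectET3DeltaPiPInv (kerDProj GprimeP GprimeP_laplacePrimeA)

/-! ## §1 (G): the column operator `G′ᴾ∘R_S∘D*` inverts `D_{U₀}` on `N_S ⊖ ker D` -/

section Member

variable {F : T3Family} {n K : ℕ} {h : n ≤ K} {c₀ cB a : ℝ} [Fact (0 < c₀)] [Fact (0 < cB)]

/-- ★ **(G) `G′ᴾ(U₀) R_S(U₀) D*_{U₀} (D_{U₀}ν) = ν − P₀(U₀)ν` FOR `ν ∈ N_S(U₀)`**, every background, every `0 ≤ a`: `D*D = Δ^η`; `R_S` fixes `Δ^ηN_S`; `Δ′_aν = Δ^ην` on `N_S`; `G′ᴾΔ′_a = 1 − P₀`.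
[cite: Balaban1985BackgroundPropagators, (3.21)–(3.25) p.394, (3.118) p.419] -/
theorem GprimeP_RS_DstarL2_DL2_of_mem_NS (ha : 0 ≤ a) (U₀ : GaugeField (F.P K) 0 (Matrix.specialUnitaryGroup (Fin 2) ℂ)) {l : SiteL2K ℂ 3 (periodsT3 F K) c₀ W₂}
    (hl : l ∈ NS F n K h c₀ cB U₀) :
    GprimeP F n K h c₀ cB a U₀ (RS F n K h c₀ cB U₀ (DstarL2 F n K c₀ U₀ (DL2 F n K c₀ U₀ l))) = l - kerDProj F n K c₀ U₀ l := by
  have hc : DstarL2 F n K c₀ U₀ (DL2 F n K c₀ U₀ l) = covLapSite F n K c₀ U₀ l := rfl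
  rw [hc, RS_apply_covLapSite_of_mem U₀ hl, ← laplacePrimeA_apply_of_mem_NS (a := a) U₀ hl, GprimeP_laplacePrimeA ha]

/-- (G) read back on the route carriers: for `toL2S ν ∈ N_S(U₀)`, the column map applied to `toL2⁻¹(D_{U₀}(toL2S ν))` returns `ν − toL2S⁻¹(P₀(toL2S ν))`.
[cite: Balaban1985BackgroundPropagators, (3.21)–(3.25) p.394] -/
theorem column_DL2_eq (ha : 0 ≤ a) (U₀ : GaugeField (F.P K) 0 (Matrix.specialUnitaryGroup (Fin 2) ℂ)) (lam : Site (F.P K) 0 → Matrix (Fin 2) (Fin 2) ℂ)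
    (hlam : toL2S F K c₀ lam ∈ NS F n K h c₀ cB U₀) :
    (toL2S F K c₀).symm (GprimeP F n K h c₀ cB a U₀ (RS F n K h c₀ cB U₀ (DstarL2 F n K c₀ U₀
        (toL2 F K c₀ ((toL2 F K c₀).symm (DL2 F n K c₀ U₀ (toL2S F K c₀ lam)))))))
      = lam - (toL2S F K c₀).symm (kerDProj F n K c₀ U₀ (toL2S F K c₀ lam)) := by
  rw [LinearEquiv.apply_symm_apply, GprimeP_RS_DstarL2_DL2_of_mem_NS ha U₀ hlam, map_sub, LinearEquiv.symm_apply_apply]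

/-- ★★ **THE ℓ¹-POINCARÉ INEQUALITY ON `N_S(U₀)` FROM ONE-BOND COLUMN BOUNDS** (member form): if every one-bond column of `toL2S⁻¹∘G′ᴾR_SD*∘toL2` has ℓ¹ mass `≤ p·‖E‖`, then
`Σ_x ‖(ν − toL2S⁻¹P₀ toL2S ν)(x)‖ ≤ p · Σ_b ‖(toL2⁻¹ D_{U₀} toL2S ν)(b)‖` for every `ν` with `toL2S ν ∈ N_S(U₀)` (decompose `Dν` over `Pi.single`, linearity, triangle inequality, (G)).
[cite: Balaban1985BackgroundPropagators, (3.118)–(3.119) p.419; Balaban1985Variational, (138)–(139) p.299] -/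
theorem l1_sub_kerDProj_le_of_columns (ha : 0 ≤ a) (U₀ : GaugeField (F.P K) 0 (Matrix.specialUnitaryGroup (Fin 2) ℂ)) (p : ℝ)
    (hcol : ∀ (bd : PBond (F.P K) 0) (E : Matrix (Fin 2) (Fin 2) ℂ),
      ∑ x : Site (F.P K) 0, ‖(toL2S F K c₀).symm (GprimeP F n K h c₀ cB a U₀
        (RS F n K h c₀ cB U₀ (DstarL2 F n K c₀ U₀ (toL2 F K c₀ (Pi.single bd E))))) x‖ ≤ p * ‖E‖)
    (lam : Site (F.P K) 0 → Matrix (Fin 2) (Fin 2) ℂ) (hlam : toL2S F K c₀ lam ∈ NS F n K h c₀ cB U₀) :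
    ∑ x : Site (F.P K) 0, ‖(lam - (toL2S F K c₀).symm (kerDProj F n K c₀ U₀ (toL2S F K c₀ lam))) x‖
      ≤ p * ∑ b : PBond (F.P K) 0, ‖((toL2 F K c₀).symm (DL2 F n K c₀ U₀ (toL2S F K c₀ lam))) b‖ := by
  classical
  -- the column map as ONE linear map on the route carriers
  set T : (PBond (F.P K) 0 → Matrix (Fin 2) (Fin 2) ℂ) →ₗ[ℂ] (Site (F.P K) 0 → Matrix (Fin 2) (Fin 2) ℂ) :=
    (toL2S F K c₀).symm.toLinearMap ∘ₗ GprimeP F n K h c₀ cB a U₀ ∘ₗ RS F n K h c₀ cB U₀ ∘ₗ DstarL2 F n K c₀ U₀ ∘ₗ (toL2 F K c₀).toLinearMap with hT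
  have hT_apply : ∀ A : PBond (F.P K) 0 → Matrix (Fin 2) (Fin 2) ℂ,
      T A = (toL2S F K c₀).symm (GprimeP F n K h c₀ cB a U₀ (RS F n K h c₀ cB U₀ (DstarL2 F n K c₀ U₀ (toL2 F K c₀ A)))) := fun A => rfl
  -- the bond components of `Dν`
  set X : PBond (F.P K) 0 → Matrix (Fin 2) (Fin 2) ℂ := (toL2 F K c₀).symm (DL2 F n K c₀ U₀ (toL2S F K c₀ lam)) with hX
  -- (G): the left-hand side is `T X`
  have hlhs : lam - (toL2S F K c₀).symm (kerDProj F n K c₀ U₀ (toL2S F K c₀ lam)) = T X := by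
    rw [hT_apply, hX, column_DL2_eq ha U₀ lam hlam]
  -- decompose `X` over one-bond fields
  have hdec : T X = ∑ b : PBond (F.P K) 0, T (Pi.single b (X b)) := by
    conv_lhs => rw [← Finset.univ_sum_single X]
    rw [map_sum]
  rw [hlhs, hdec]
  -- pointwise triangle inequality, then swap the sums
  calc ∑ x : Site (F.P K) 0, ‖(∑ b : PBond (F.P K) 0, T (Pi.single b (X b))) x‖
      ≤ ∑ x : Site (F.P K) 0, ∑ b : PBond (F.P K) 0, ‖T (Pi.single b (X b)) x‖ := by
        refine Finset.sum_le_sum fun x _ => ?_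
        rw [Finset.sum_apply]
        exact norm_sum_le _ _
    _ = ∑ b : PBond (F.P K) 0, ∑ x : Site (F.P K) 0, ‖T (Pi.single b (X b)) x‖ := Finset.sum_comm
    _ ≤ ∑ b : PBond (F.P K) 0, p * ‖X b‖ := by
        refine Finset.sum_le_sum fun b _ => ?_
        rw [hT_apply]
        exact hcol b (X b)
    _ = p * ∑ b : PBond (F.P K) 0, ‖X b‖ := by rw [Finset.mul_sum]

end Member

/-! ## §2 At the EX display's letters: `hPcol` (S42ᴸ :185–188, VERBATIM) ⟹ the uniform ℓ¹-Poincaré inequality on `N_S` over `RegPr (αcap L)` -/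

/-- ★★ **`hPcol` ⟹ ℓ¹-POINCARÉ ON THE RESIDUAL GAUGE ALGEBRA, UNIFORMLY OVER THE PRINTED-REGULAR CLASS**: from the displayed row `hPcol` of ✓`Prop7StubEXOfChartPiecesTwS42L` (binder text
token for token), for every `L > 1`, member `i`, background `U₀ ∈ RegPr ρ`, `ρ ≤ αcap L`, and every gauge parameter `ν` with `toL2S ν ∈ N_S(U₀)`:
`Σ_x ‖(ν − toL2S⁻¹ P₀(U₀) toL2S ν)(x)‖ ≤ p139 L · Σ_b ‖(toL2⁻¹ D_{U₀} toL2S ν)(b)‖` — the socket at which the `Lift` antecedent of record must enter (module docstring).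
[cite: Balaban1985Variational, (138)–(139) p.299; Balaban1985BackgroundPropagators, (3.21)–(3.25) p.394, (3.118)–(3.119) p.419] -/
theorem l1Poincare_NS_of_hPcol
    (αcap : ℕ → ℝ) (c₀ cB : ℕ → ℝ) [hc₀ : ∀ L : ℕ, Fact (0 < c₀ L)] [hcB : ∀ L : ℕ, Fact (0 < cB L)]
    (a : ∀ L : ℕ, Idx L → ℝ) (ha : ∀ (L : ℕ) (i : Idx L), 0 < a L i) (p139 : ℕ → ℝ)
    (hPcol : ∀ (L : ℕ), 1 < L → ∀ (i : Idx L) (U₀ : GaugeField (i.1.1.P i.1.2.2) 0 (Matrix.specialUnitaryGroup (Fin 2) ℂ)), ∀ ρ : ℝ, RegPr i.1.1 i.1.2.1 i.1.2.2 ρ U₀ → ρ ≤ αcap L →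
      ∀ (bd : PBond (i.1.1.P i.1.2.2) 0) (E : Matrix (Fin 2) (Fin 2) ℂ),
        ∑ x : Site (i.1.1.P i.1.2.2) 0, ‖(toL2S i.1.1 i.1.2.2 (c₀ L)).symm (GprimeP i.1.1 i.1.2.1 i.1.2.2 i.2.2.le (c₀ L) (cB L) (a L i) U₀
          (RS i.1.1 i.1.2.1 i.1.2.2 i.2.2.le (c₀ L) (cB L) U₀ (DstarL2 i.1.1 i.1.2.1 i.1.2.2 (c₀ L) U₀ (toL2 i.1.1 i.1.2.2 (c₀ L) (Pi.single bd E))))) x‖ ≤ p139 L * ‖E‖) :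
    ∀ (L : ℕ), 1 < L → ∀ (i : Idx L) (U₀ : GaugeField (i.1.1.P i.1.2.2) 0 (Matrix.specialUnitaryGroup (Fin 2) ℂ)), ∀ ρ : ℝ, RegPr i.1.1 i.1.2.1 i.1.2.2 ρ U₀ → ρ ≤ αcap L →
      ∀ lam : Site (i.1.1.P i.1.2.2) 0 → Matrix (Fin 2) (Fin 2) ℂ, toL2S i.1.1 i.1.2.2 (c₀ L) lam ∈ NS i.1.1 i.1.2.1 i.1.2.2 i.2.2.le (c₀ L) (cB L) U₀ →
        ∑ x : Site (i.1.1.P i.1.2.2) 0, ‖(lam - (toL2S i.1.1 i.1.2.2 (c₀ L)).symm (kerDProj i.1.1 i.1.2.1 i.1.2.2 (c₀ L) U₀ (toL2S i.1.1 i.1.2.2 (c₀ L) lam))) x‖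
          ≤ p139 L * ∑ b : PBond (i.1.1.P i.1.2.2) 0, ‖((toL2 i.1.1 i.1.2.2 (c₀ L)).symm (DL2 i.1.1 i.1.2.1 i.1.2.2 (c₀ L) U₀ (toL2S i.1.1 i.1.2.2 (c₀ L) lam))) b‖ := by
  intro L hL i U₀ ρ hreg hρ lam hlam
  exact l1_sub_kerDProj_le_of_columns (h := i.2.2.le) (ha L i).le U₀ (p139 L) (fun bd E => hPcol L hL i U₀ ρ hreg hρ bd E) lam hlam

end Summit.QuantumFields.YangMills.Theorems.Prop7PcolImpliesNSPoincare

end
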